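import Summits.NavierStokesRegularity.NavierStokesRegularity.Theorems.UnthreadedDoorCellFluxSimilarity
import Summits.NavierStokesRegularity.NavierStokesRegularity.Theorems.UnthreadedDoorCellFluxWindowDecayDefs
import HarnessLib

/-!
# Route `UnthreadedDoor`, crux `PoloidalLiouville` (stmt-NavierStokesRegularity-1222), WALL W1 — crux idea «cell-flux» (ns-idea-14):
# Σ-0e `ClusterFluxTimeLipschitz` BY NAME from Σ-0b′ / from Σ-0bR₂ alone

Support file (theorems only; `--supports stmt-NavierStokesRegularity-1222 --as helper`).  Bookkeeping over the landed
`UnthreadedDoorCellFluxSimilarity` (p726788, `clusterFlux_timeLipschitz_of_nearCentreLinked`: Σ-0e ⇐ Σ-0b′ by parabolic rescaling) and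
ns-qj-p1 g8's Defs twin `UnthreadedDoorCellFluxWindowDecayDefs` (p726325: the Props `ClusterFluxNearCentreLinked` (Σ-0b′),
`ClusterFluxNearCentreLipschitz` (Σ-0bR₂), `ClusterFluxTimeLipschitz` (Σ-0e) and the glue `clusterFluxNearCentreLinked_of_lipschitz` = Σ-0bR₁
p718757 ∘ Σ-0a p717414): the NAMED implications `ClusterFluxNearCentreLinked → ClusterFluxTimeLipschitz` and
`ClusterFluxNearCentreLipschitz → ClusterFluxTimeLipschitz` — Σ-0e (the cluster analogue of AE-3, consumed by Σ-3′ p726682) reduces BY NAME to the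
single open near-centre stub Σ-0bR₂.  Nothing here is about Navier–Stokes; ⟨1222⟩, W1 and NS regularity stay OPEN.  ARM A
`pub/ns-exp-scalarLiouville` g8.
-/

noncomputable section

-- the summit and its single sub-problem share the name (CONVENTIONS §1)
set_option linter.dupNamespace false

namespace Summit.NavierStokesRegularity.NavierStokesRegularity.Theorems.PoloidalLiouville.CellFlux

/-- ★ **Σ-0e BY NAME from Σ-0b′**: `ClusterFluxNearCentreLinked → ClusterFluxTimeLipschitz` (parabolic rescaling, p726788). [folklore] -/
theorem clusterFluxTimeLipschitz_of (h : ClusterFluxNearCentreLinked) : ClusterFluxTimeLipschitz :=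
  clusterFlux_timeLipschitz_of_nearCentreLinked h

/-- ★ **Σ-0e BY NAME from Σ-0bR₂ alone**: `ClusterFluxNearCentreLipschitz → ClusterFluxTimeLipschitz` (Σ-0bR₁ is the landed
`clusterFluxNearCentreCap_of clusterFluxLeVorticity`, via ns-qj-p1 g8's glue `clusterFluxNearCentreLinked_of_lipschitz`). [folklore] -/
theorem clusterFluxTimeLipschitz_of_lipschitz (h : ClusterFluxNearCentreLipschitz) : ClusterFluxTimeLipschitz :=
  clusterFluxTimeLipschitz_of (clusterFluxNearCentreLinked_of_lipschitz h)

end Summit.NavierStokesRegularity.NavierStokesRegularity.Theorems.PoloidalLiouville.CellFlux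

end
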